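import Summits.BirchSwinnertonDyer.Rank1Residual.Additive.CyclotomicThreeRankOneTwistDescentData
import Summits.BirchSwinnertonDyer.Rank1Residual.Additive.CyclotomicThreeRankOneDescentData
import Literature.NumberTheory.EllipticCurves.VariableChangePointsMap
import Literature.NumberTheory.EllipticCurves.HeightsBaseChangeProofs
import Literature.NumberTheory.EllipticCurves.PAdicHeightsK
import HarnessLib

/-!
# Rank `(1,1)` descent algebra over a quadratic field: two-element Mordell–Weil bases, Gram
# determinants of a pair of points, Galois ORTHOGONALITY of the `(+)`- and `(−)`-parts, and a twisting
# transport that is ANTI-invariant under the conjugation (cell `b2b-bsdres`, team n1011, seat p16;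
# OWNERS row T-S9-K = sub-target (S9), file 1 of 2 of its descent data)

HONEST FRAMING (cell `b2b-bsdres`, run/shared/lean/b2b/bsd-rank1-residual/, verbatim in every
file): the goal of the cell is to DELETE the COMBINATION-SHAPED residual classes of the
Birch–Swinnerton-Dyer formula for ALL analytic-rank `≤ 1` elliptic curves over `ℚ` — "full BSD
formula for every rank `≤ 1` curve in class `C`" assembled STRICTLY from published theorems — so
that the rank-`≤ 1` remainder becomes exactly the CONSTRUCTION-SHAPED classes, which are TYPED
(missing-input `Prop`s), NOT attempted. This is not "finishing BSD". Team n1011 (N10 / N11 / O7),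
seat p16: research route; the labels of X3 / X4 and the N10 / N11 / O7 marks are UNCHANGED by this
file; nothing is booked here.

Theorems only (no `def`, no `sorry`, no named fact); fact-free kernel bookkeeping. For the
`(r_an V, r_an W) = (1,1)` twin of the `K`-side LOWER chain (`XGordRankOneZeroCyclotomicThreeLowerK`,
ranks `(0,1)`), `V(K)` has rank TWO over the quadratic field `K` (`= 1 + 1`, Silverman *AEC* Exercise
10.16, tree `mordellWeilRank_baseChange_of_finrank_eq_two`), generated up to finite index by
`ι(V(ℚ))` and the image `Φ(W(ℚ))` of the twist under a twisting transport. What is needed downstream,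
and proved here:

* §1 `pairing_comb_comb`, `gram_det_comb_comb` — for a symmetric, torsion-vanishing bilinear pairing
  `β` and `x = aQ₀ + bQ₁ + t`, `y = cQ₀ + dQ₁ + t'` (`t, t'` torsion):
  `β(x,x)β(y,y) − β(x,y)² = (ad − bc)²·(β(Q₀,Q₀)β(Q₁,Q₁) − β(Q₀,Q₁)²)` (Gram determinant of a sublattice
  = index² · Gram determinant); `pairing_eq_zero_of_invariant` — a pairing invariant under a map `s`
  pairs an `s`-fixed vector and an `s`-anti-fixed vector to `0` (characteristic `0`);
  `exists_heightPairingHom` — the Néron–Tate pairing bundled as `→+ →+` (tree bilinearity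
  `heightPairing_add_left_holds` / `heightPairing_add_right`).
* §2 `exists_eq_comb_add_torsion_of_isMordellWeilBasis_two`, `isMordellWeilBasis_comp_equiv`,
  `regulator_eq_det_of_isMordellWeilBasis_two` — bookkeeping for two-element Mordell–Weil bases.
* §3 **`heightPairing_eq_zero_of_conjMap`** — GALOIS ORTHOGONALITY of Néron–Tate heights over `K`: if
  the conjugation `σ` of `K/ℚ` fixes `x ∈ V(K)` and negates `y ∈ V(K)` then `⟨x, y⟩_K = 0` (the height
  pairing is `σ`-invariant: tree theorem `heightPairing_map_self`, Bombieri–Gubler 1.5.17 / Silverman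
  VIII.5.4); `padicHeightK_eq_zero_of_conjMap` — the same for a `K`-height datum ASSUMED `σ`-invariant.
* §4 **`exists_conj_twistTransport`** — for `K ∋ θ ∉ ℚ`, `θ² = c`, `W = C • V^{(c)}`: the conjugation
  `σ` (`σθ = −θ`, tree `Quadratic.conj`) and a twisting transport `Φ : W(ℚ) →+ V(K)` DOUBLING
  Néron–Tate heights AND ANTI-INVARIANT under `σ` (`σ_* ∘ Φ = −Φ`): `Φ = e⁻¹ ∘ g⁻¹ ∘ τ ∘ e₀⁻¹` with
  `τ` the twisting map (tree `QuadraticDescent.twistMap`, anti-invariant by `conjMap_twistMap`,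
  Silverman X.2 / X.5.4), `e = pointEquivBaseChange V C₁ K` the completion of the square (a change of
  variables over `ℚ`, hence `σ`-equivariant: tree `pointEquivBaseChange_symm_map`), `g` a transport
  along an equality of equations (`congrEquiv_baseChange_map`), `e₀` the change of variables `C`.

References: [SilvermanAEC2009] VIII.5.4(b), VIII.9.3, X.2 Prop. 2.4, X.5 Cor. 5.4, Exercise 10.16;
[BombieriGubler2001] Prop. 1.5.17; [MazurTateTeitelbaum1986Invent] §II.4–5 (heights over `K`).
-/

noncomputable section

open scoped Classical

open WeierstrassCurve WeierstrassCurve.Affine.Point Literature.NumberTheory.EllipticCurves NumberField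

namespace Summit.BirchSwinnertonDyer.Rank1Residual.Additive

/-! ## §1 Pairing algebra: Gram determinant of a pair of combinations; invariance ⟹ orthogonality -/

section PairingAlgebra

variable {A R : Type*} [AddCommGroup A] [CommRing R]

/-- Expansion of a symmetric torsion-vanishing bilinear pairing on two integer combinations of
`Q₀, Q₁` plus torsion: `β(aQ₀ + bQ₁ + t, cQ₀ + dQ₁ + t') = ac·β₀₀ + (ad + bc)·β₀₁ + bd·β₁₁`. [folklore] -/
theorem pairing_comb_comb (β : A →+ A →+ R) (htors : ∀ P Q, IsOfFinAddOrder P → β P Q = 0)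
    (hsymm : ∀ P Q, β P Q = β Q P) (Q₀ Q₁ : A) (a b c d : ℤ) {t t' : A}
    (ht : IsOfFinAddOrder t) (ht' : IsOfFinAddOrder t') :
    β (a • Q₀ + b • Q₁ + t) (c • Q₀ + d • Q₁ + t') =
      (a * c : R) * β Q₀ Q₀ + (a * d + b * c : R) * β Q₀ Q₁ + (b * d : R) * β Q₁ Q₁ := by
  have hR : ∀ (x : A) (m : ℤ) (Q : A), β x (m • Q) = (m : R) * β x Q := fun x m Q ↦ by
    rw [map_zsmul, zsmul_eq_mul]
  have hL : ∀ (m : ℤ) (P y : A), β (m • P) y = (m : R) * β P y := fun m P y ↦ by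
    rw [hsymm, hR, hsymm]
  have htL : ∀ y, β t y = 0 := fun y ↦ htors t y ht
  have htR : ∀ x, β x t' = 0 := fun x ↦ by rw [hsymm]; exact htors t' x ht'
  simp only [map_add, AddMonoidHom.add_apply, hL, hR, htL, htR, hsymm Q₁ Q₀]
  ring

/-- **Gram determinant of a pair of combinations = (index determinant)² × Gram determinant**: for a
symmetric torsion-vanishing bilinear `β`, `x = aQ₀ + bQ₁ + t`, `y = cQ₀ + dQ₁ + t'` (`t, t'` torsion),
`β(x,x)·β(y,y) − β(x,y)² = (ad − bc)²·(β(Q₀,Q₀)·β(Q₁,Q₁) − β(Q₀,Q₁)²)` (`det(A G Aᵀ) = det(A)² det G`).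
[folklore] -/
theorem gram_det_comb_comb (β : A →+ A →+ R) (htors : ∀ P Q, IsOfFinAddOrder P → β P Q = 0)
    (hsymm : ∀ P Q, β P Q = β Q P) (Q₀ Q₁ : A) (a b c d : ℤ) {t t' : A}
    (ht : IsOfFinAddOrder t) (ht' : IsOfFinAddOrder t') :
    β (a • Q₀ + b • Q₁ + t) (a • Q₀ + b • Q₁ + t) * β (c • Q₀ + d • Q₁ + t') (c • Q₀ + d • Q₁ + t') -
        β (a • Q₀ + b • Q₁ + t) (c • Q₀ + d • Q₁ + t') ^ 2 =
      ((a * d - b * c : ℤ) : R) ^ 2 * (β Q₀ Q₀ * β Q₁ Q₁ - β Q₀ Q₁ ^ 2) := by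
  rw [pairing_comb_comb β htors hsymm Q₀ Q₁ a b a b ht ht,
    pairing_comb_comb β htors hsymm Q₀ Q₁ c d c d ht' ht',
    pairing_comb_comb β htors hsymm Q₀ Q₁ a b c d ht ht']
  push_cast
  ring

/-- **Invariance ⟹ orthogonality of the `(+)`- and `(−)`-parts**: a pairing `β` invariant under a
map `s` (`β(sx, sy) = β(x, y)`) pairs an `s`-fixed `x` and an `s`-anti-fixed `y` to `0`, in
characteristic `0` (`β(x,y) = β(x,−y) = −β(x,y)`). [folklore] -/
theorem pairing_eq_zero_of_invariant [IsDomain R] [CharZero R] (β : A →+ A →+ R) (s : A → A)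
    (hinv : ∀ x y, β (s x) (s y) = β x y) {x y : A} (hx : s x = x) (hy : s y = -y) :
    β x y = 0 := by
  have h : β x y = -β x y := by
    conv_lhs => rw [← hinv x y, hx, hy, map_neg]
  have h2 : (2 : R) * β x y = 0 := by
    rw [two_mul]
    nth_rewrite 1 [h]
    exact neg_add_cancel _
  have h20 : (2 : R) ≠ 0 := by exact_mod_cast (two_ne_zero : (2 : ℕ) ≠ 0)
  exact (mul_eq_zero.mp h2).resolve_left h20

/-- The Néron–Tate height pairing of an elliptic curve over a number field, bundled as a biadditive
map `E(F) →+ E(F) →+ ℝ` (tree bilinearity: `heightPairing_add_left_holds`, `heightPairing_add_right`;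
Silverman *AEC* Thm. VIII.9.3(c)). [cite: SilvermanAEC2009, Thm. VIII.9.3(c)] -/
theorem exists_heightPairingHom {F : Type*} [Field F] [NumberField F] (E : WeierstrassCurve F)
    [E.IsElliptic] :
    ∃ β : E.toAffine.Point →+ E.toAffine.Point →+ ℝ, ∀ P Q, β P Q = heightPairing P Q :=
  ⟨AddMonoidHom.mk' (fun P ↦ AddMonoidHom.mk' (fun Q ↦ heightPairing P Q) (heightPairing_add_right P))
      (fun P P' ↦ by ext Q; exact heightPairing_add_left_holds P P' Q), fun _ _ ↦ rfl⟩

end PairingAlgebra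

/-! ## §2 Two-element Mordell–Weil bases -/

section BasisTwo

variable {F : Type*} [Field F] {E : WeierstrassCurve F}

/-- Every point is an integer combination of a two-element Mordell–Weil basis up to torsion. [folklore] -/
theorem exists_eq_comb_add_torsion_of_isMordellWeilBasis_two {B : Fin 2 → E.toAffine.Point}
    (hB : IsMordellWeilBasis B) (P : E.toAffine.Point) :
    ∃ (a b : ℤ) (t : E.toAffine.Point), IsOfFinAddOrder t ∧ P = a • B 0 + b • B 1 + t := by
  have hmem : (QuotientAddGroup.mk P : mordellWeilModTorsion E) ∈
      Submodule.span ℤ (Set.range (QuotientAddGroup.mk ∘ B : Fin 2 → mordellWeilModTorsion E)) := by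
    rw [hB.2]; exact Submodule.mem_top
  obtain ⟨c, hc⟩ := (Submodule.mem_span_range_iff_exists_fun ℤ).mp hmem
  rw [Fin.sum_univ_two] at hc
  simp only [Function.comp_apply] at hc
  refine ⟨c 0, c 1, -(c 0 • B 0 + c 1 • B 1) + P, ?_, by abel⟩
  have h1 : (QuotientAddGroup.mk (c 0 • B 0 + c 1 • B 1) : mordellWeilModTorsion E) =
      QuotientAddGroup.mk P := by
    rw [← hc, QuotientAddGroup.mk_add, QuotientAddGroup.mk_zsmul, QuotientAddGroup.mk_zsmul]
  exact (AddCommGroup.mem_torsion _).mp (QuotientAddGroup.eq.mp h1)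

/-- Reindexing a Mordell–Weil basis along an equivalence of index types. [folklore] -/
theorem isMordellWeilBasis_comp_equiv {ι ι' : Type*} {B : ι → E.toAffine.Point}
    (hB : IsMordellWeilBasis B) (e : ι' ≃ ι) : IsMordellWeilBasis (B ∘ e) := by
  refine ⟨?_, ?_⟩
  · have h := hB.1.comp e e.injective
    exact h
  · have hr : Set.range (QuotientAddGroup.mk ∘ (B ∘ e) : ι' → mordellWeilModTorsion E) =
        Set.range (QuotientAddGroup.mk ∘ B : ι → mordellWeilModTorsion E) := by
      rw [show (QuotientAddGroup.mk ∘ (B ∘ e) : ι' → mordellWeilModTorsion E) =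
        (QuotientAddGroup.mk ∘ B) ∘ e from rfl, EquivLike.range_comp]
    rw [hr, hB.2]

/-- A Mordell–Weil basis indexed by `Fin r` with `r = 2`, re-indexed by `Fin 2`. [folklore] -/
theorem isMordellWeilBasis_finCongr {r : ℕ} (hr : r = 2) {B : Fin r → E.toAffine.Point}
    (hB : IsMordellWeilBasis B) : IsMordellWeilBasis (B ∘ finCongr hr.symm) :=
  isMordellWeilBasis_comp_equiv hB (finCongr hr.symm)

/-- **The regulator on a two-element Mordell–Weil basis**: over a number field,
`Reg(E) = ⟨B₀,B₀⟩⟨B₁,B₁⟩ − ⟨B₀,B₁⟩²` (the `2 × 2` Gram determinant; Silverman *AEC* VIII.9, Gross 2011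
§4 — basis independence is the tree's `IsMordellWeilBasis.regulatorOf_eq_regulator`).
[cite: Gross2011, Lecture 1 §4, Def. 1.6] -/
theorem regulator_eq_det_of_isMordellWeilBasis_two [NumberField F] [E.IsElliptic]
    {B : Fin 2 → E.toAffine.Point} (hB : IsMordellWeilBasis B) :
    E.regulator = heightPairing (B 0) (B 0) * heightPairing (B 1) (B 1) - heightPairing (B 0) (B 1) ^ 2 := by
  rw [← hB.regulatorOf_eq_regulator, regulatorOf, heightPairingMatrix, Matrix.det_fin_two]
  simp only [Matrix.of_apply]
  rw [heightPairing_symm (B 1) (B 0), sq]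

end BasisTwo

/-! ## §3 Galois orthogonality over a quadratic field -/

section Orthogonality

variable (K : Type) [Field K] [NumberField K] (V : WeierstrassCurve ℚ) [V.IsElliptic]

/-- **Galois orthogonality of Néron–Tate heights.** For `V/ℚ`, a number field `K`, an algebra
endomorphism `σ` of `K`, and `x, y ∈ V(K)` with `σx = x`, `σy = −y`: `⟨x, y⟩_K = 0` — the height
pairing relative to `K` is `σ`-invariant (tree `heightPairing_map_self`; Bombieri–Gubler Prop. 1.5.17,
Silverman *AEC* VIII.5.4(b)), so `⟨x,y⟩ = ⟨x,−y⟩ = −⟨x,y⟩`. In the application `x ∈ ι(V(ℚ))`, `y` in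
the image of the twist, and this is the orthogonality of the `(±)`-eigenspaces of `V(K) ⊗ ℚ` under
`Gal(K/ℚ)`. [cite: BombieriGubler2001, Prop. 1.5.17] [cite: SilvermanAEC2009, Prop. VIII.5.4(b)] -/
theorem heightPairing_eq_zero_of_conjMap (σ : K →ₐ[ℚ] K) {x y : (V.baseChange K).toAffine.Point}
    (hx : QuadraticDescent.conjMap V σ x = x) (hy : QuadraticDescent.conjMap V σ y = -y) :
    heightPairing x y = 0 := by
  haveI : (V.baseChange K).IsElliptic := by rw [WeierstrassCurve.baseChange]; infer_instance
  obtain ⟨β, hβ⟩ := exists_heightPairingHom (V.baseChange K)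
  rw [← hβ]
  refine pairing_eq_zero_of_invariant β (QuadraticDescent.conjMap V σ) (fun P Q ↦ ?_) hx hy
  rw [hβ, hβ]
  exact heightPairing_map_self (W := V) σ P Q

omit [V.IsElliptic] in
/-- **Galois orthogonality for a `σ`-INVARIANT `K`-height datum**: if `DK(σx, σy) = DK(x, y)` for all
`x, y` (true for Schneider's / Mazur–Tate's analytic `p`-adic height of `V_K`, a sum of `σ`-permuted
local terms — Mazur–Tate–Teitelbaum 1986 §II.4–5; here an explicit HYPOTHESIS on the datum), then
`σx = x`, `σy = −y` imply `DK(x, y) = 0`. [cite: MazurTateTeitelbaum1986Invent, §II.4–5] -/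
theorem padicHeightK_eq_zero_of_conjMap {p : ℕ} [Fact p.Prime] (DK : PAdicHeightDataK V p K)
    (σ : K →ₐ[ℚ] K)
    (hinv : ∀ x y, DK.pairing (QuadraticDescent.conjMap V σ x) (QuadraticDescent.conjMap V σ y) =
      DK.pairing x y)
    {x y : (V.baseChange K).toAffine.Point}
    (hx : QuadraticDescent.conjMap V σ x = x) (hy : QuadraticDescent.conjMap V σ y = -y) :
    DK.pairing x y = 0 :=
  pairing_eq_zero_of_invariant DK.pairing (QuadraticDescent.conjMap V σ) hinv hx hy

omit [V.IsElliptic] in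
/-- `σ` fixes the image of `V(ℚ)` in `V(K)` (`pointToBaseChange` of `PAdicHeightsK` is Mathlib's base
change on points; tree `QuadraticDescent.conjMap_incl`). [folklore] -/
theorem conjMap_pointToBaseChange (σ : K →ₐ[ℚ] K) (P : V.toAffine.Point) :
    QuadraticDescent.conjMap V σ (V.pointToBaseChange K P) = V.pointToBaseChange K P := by
  rw [pointToBaseChange_eq_baseChange]
  exact QuadraticDescent.conjMap_incl V σ P

end Orthogonality

/-! ## §4 A twisting transport doubling Néron–Tate heights and ANTI-invariant under the conjugation -/

section Transport

variable (K : Type) [Field K] [NumberField K] (V : WeierstrassCurve ℚ) [V.IsElliptic]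
  (W : WeierstrassCurve ℚ) [W.IsElliptic]

omit [W.IsElliptic] in
/-- **Existence of the conjugation and of an anti-invariant twisting transport.** For a number field
`K ∋ θ` with `θ ∉ ℚ`, `θ² = c`, `[K:ℚ] = 2`, and `W = C • V^{(c)}`: there are the conjugation
`σ : K →ₐ[ℚ] K` (`σθ = −θ`; tree `Quadratic.conj`) and an additive `Φ : W(ℚ) →+ V(K)` with
`⟨ΦP, ΦP⟩_K = 2·⟨P,P⟩_ℚ` (as in `exists_twistTransport`) AND `σ_*(ΦP) = −ΦP` for every `P ∈ W(ℚ)`: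
`Φ = e⁻¹ ∘ g⁻¹ ∘ τ ∘ e₀⁻¹`, `τ : V^{(c)}(ℚ) → V^{(1)}(K)` the twisting map `(X,Y) ↦ (X/θ², Y/θ³)`
(`QuadraticDescent.twistMap`, anti-invariant: `conjMap_twistMap`, Silverman *AEC* X.2 Prop. 2.4 /
X.5.4; doubling heights: VIII.5.4(b)), `e : V(K) ≃ (C₁ • V)(K)` the completion of the square defined
over `ℚ` (`pointEquivBaseChange`, `σ`-equivariant: `pointEquivBaseChange_symm_map`), `g` the transport
along `(C₁ • V)_K = V^{(1)}_K` (`congrEquiv_baseChange_map`), `e₀ : V^{(c)}(ℚ) ≃ W(ℚ)` the change of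
variables `C` (all preserving canonical heights, VIII.9.3).
[cite: SilvermanAEC2009, X.5 Cor. 5.4, Prop. VIII.5.4(b), Thm. VIII.9.3] -/
theorem exists_conj_twistTransport (h2 : Module.finrank ℚ K = 2) {θ : K} {c : ℚ}
    (hθ : θ ∉ Set.range (algebraMap ℚ K)) (hc : θ ^ 2 = algebraMap ℚ K c)
    (C : VariableChange ℚ) (hC : C • V.quadraticTwist c = W) :
    ∃ (σ : K →ₐ[ℚ] K) (Φ : W.toAffine.Point →+ (V.baseChange K).toAffine.Point),
      σ θ = -θ ∧
      (∀ P : W.toAffine.Point, heightPairing (Φ P) (Φ P) = 2 * heightPairing P P) ∧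
      (∀ P : W.toAffine.Point, QuadraticDescent.conjMap V σ (Φ P) = -Φ P) := by
  haveI : NeZero (2 : ℚ) := ⟨two_ne_zero⟩
  have hc0 : c ≠ 0 := by
    rintro rfl
    have hθ0 : θ = 0 := by
      have h : θ ^ 2 = 0 := by rw [hc, _root_.map_zero]
      exact pow_eq_zero_iff (n := 2) two_ne_zero |>.mp h
    exact hθ ⟨0, by rw [_root_.map_zero, hθ0]⟩
  haveI : (V.quadraticTwist c).IsElliptic := V.isElliptic_quadraticTwist hc0
  haveI : (V.baseChange K).IsElliptic := by rw [WeierstrassCurve.baseChange]; infer_instance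
  set σ := Literature.NumberTheory.QuadraticFields.Quadratic.conj h2 hθ hc with hσdef
  have hσθ : σ θ = -θ := Literature.NumberTheory.QuadraticFields.Quadratic.conj_gen h2 hθ hc
  obtain ⟨C₁, hC₁⟩ := V.exists_variableChange_quadraticTwist_one
  haveI : (V.quadraticTwist 1).IsElliptic := V.isElliptic_quadraticTwist one_ne_zero
  haveI : (C₁ • V).IsElliptic := by rw [hC₁]; infer_instance
  have hC₁K : (C₁ • V).baseChange K = (V.quadraticTwist 1).baseChange K :=
    congrArg (fun X : WeierstrassCurve ℚ ↦ X.baseChange K) hC₁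
  -- the maps: `e₀` (over `ℚ`), `e` (completion of the square, over `K`), `g` (transport), `τ`
  obtain ⟨e₀, he₀⟩ := exists_addEquiv_heightPairing_eq_of_smul_eq C hC
  set e : (V.baseChange K).toAffine.Point ≃+ ((C₁ • V).baseChange K).toAffine.Point :=
    VariableChange.pointEquivBaseChange V C₁ K with he_def
  set g : ((C₁ • V).baseChange K).toAffine.Point ≃+ ((V.quadraticTwist 1).baseChange K).toAffine.Point :=
    Affine.Point.congrEquiv hC₁K with hg_def
  obtain ⟨τ, hτf⟩ : ∃ g' : (V.quadraticTwist c).toAffine.Point →+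
      ((V.quadraticTwist 1).baseChange K).toAffine.Point, ∀ P, g' P = QuadraticDescent.twistMap V hθ hc P :=
    exists_addMonoidHom_coe_eq_of_decEq _ _ (QuadraticDescent.twistMap V hθ hc)
  -- heights
  have hτ : ∀ R : (V.quadraticTwist c).toAffine.Point,
      heightPairing (τ R) (τ R) = 2 * heightPairing R R := by
    intro R
    rw [hτf]
    show heightPairing
        (Affine.Point.congrEquiv (twistUntwist_smul_baseChange V hθ hc)
          (VariableChange.pointEquiv _ (twistUntwist hθ) (QuadraticDescent.incl K (V.quadraticTwist c) R)))
        (Affine.Point.congrEquiv (twistUntwist_smul_baseChange V hθ hc)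
          (VariableChange.pointEquiv _ (twistUntwist hθ) (QuadraticDescent.incl K (V.quadraticTwist c) R))) = _
    rw [heightPairing_congrEquiv, heightPairing_pointEquiv]
    have h0 := heightPairing_baseChange (R := ℚ) (K := ℚ) (L := K) (W := V.quadraticTwist c) R R
    rw [h2] at h0
    push_cast at h0
    exact h0
  have he : ∀ X : (V.baseChange K).toAffine.Point, heightPairing (e X) (e X) = heightPairing X X := by
    intro X
    rw [he_def]
    show heightPairing
        (Affine.Point.congrEquiv (VariableChange.baseChange_smul_eq V C₁ K).symm
          (VariableChange.pointEquiv _ (C₁.map (algebraMap ℚ K)) X))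
        (Affine.Point.congrEquiv (VariableChange.baseChange_smul_eq V C₁ K).symm
          (VariableChange.pointEquiv _ (C₁.map (algebraMap ℚ K)) X)) = _
    rw [heightPairing_congrEquiv]
    have h' := heightPairing_pointEquiv (C₁.map (algebraMap ℚ K)) X X
    simp only [VariableChange.pointEquiv_apply] at h' ⊢
    exact h'
  have hg : ∀ Y, heightPairing (g Y) (g Y) = heightPairing Y Y := fun Y ↦ by
    rw [hg_def, heightPairing_congrEquiv]
  have he' : ∀ Y, heightPairing (e.symm Y) (e.symm Y) = heightPairing Y Y := fun Y ↦ by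
    conv_rhs => rw [← e.apply_symm_apply Y]
    exact (he (e.symm Y)).symm
  have hg' : ∀ Z, heightPairing (g.symm Z) (g.symm Z) = heightPairing Z Z := fun Z ↦ by
    conv_rhs => rw [← g.apply_symm_apply Z]
    exact (hg (g.symm Z)).symm
  have he₀' : ∀ P, heightPairing (e₀.symm P) (e₀.symm P) = heightPairing P P := fun P ↦ by
    conv_rhs => rw [← e₀.apply_symm_apply P]
    exact (he₀ (e₀.symm P)).symm
  -- Galois equivariance of `e` and `g`, anti-invariance of `τ`
  have heσ : ∀ Y, QuadraticDescent.conjMap V σ (e.symm Y) =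
      e.symm (Affine.Point.map (W' := C₁ • V) σ Y) := fun Y ↦ by
    rw [he_def]
    exact VariableChange.pointEquivBaseChange_symm_map V C₁ σ Y
  have hgσ : ∀ Z, Affine.Point.map (W' := C₁ • V) σ (g.symm Z) =
      g.symm (QuadraticDescent.conjMap (V.quadraticTwist 1) σ Z) := fun Z ↦ by
    apply g.injective
    rw [AddEquiv.apply_symm_apply, hg_def]
    have h := Affine.Point.congrEquiv_baseChange_map hC₁ σ (g.symm Z)
    rw [hg_def] at h
    rw [h, AddEquiv.apply_symm_apply]
  have hτσ : ∀ R, QuadraticDescent.conjMap (V.quadraticTwist 1) σ (τ R) = -τ R := fun R ↦ by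
    rw [hτf]
    exact QuadraticDescent.conjMap_twistMap V hθ hc hσθ R
  refine ⟨σ, e.symm.toAddMonoidHom.comp (g.symm.toAddMonoidHom.comp (τ.comp e₀.symm.toAddMonoidHom)),
    hσθ, fun P ↦ ?_, fun P ↦ ?_⟩
  · simp only [AddMonoidHom.comp_apply, AddEquiv.coe_toAddMonoidHom]
    rw [he', hg', hτ, he₀']
  · simp only [AddMonoidHom.comp_apply, AddEquiv.coe_toAddMonoidHom]
    rw [heσ, hgσ, hτσ, map_neg, map_neg]

end Transport

end Summit.BirchSwinnertonDyer.Rank1Residual.Additive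

end
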